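import Literature.MathematicalPhysics.QuantumFieldTheory.Balaban1983to89.B10StarCount
import Literature.MathematicalPhysics.QuantumFieldTheory.Balaban1983to89.B5Eq118OneStroke
import HarnessLib

/-!
# Route `UnitScaleTilt`, crux K1 child «MinimiserStabilityRegPr» (stmt-QuantumFields-19200), route-R E′ path (α′), R2 ∕ (F2) — ROW (T)-L², THE LINE CORE:
# **THE STRAIGHT-LINE PART OF THE `k`-FOLD BLOCK AVERAGE IS `L^{(2−d)k∕2}`-BOUNDED FROM `ℓ²(fine bonds)` TO `ℓ²(coarse bonds)`**

Cell `ym3-torus`, width seat `ym3-torus-px12` (gen 3; LOCATE memo `pub/ym3-torus/ym3-torus-px12/g3/LOCATE-ROW-T-L2-px12g3.md`, 19200 evidence #53).  THEOREMS ONLY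
(0 `def`, 0 `sorry`); `--supports stmt-QuantumFields-19200 --as helper`, count-neutral.  YM₃ on T³ is a ladder rung (R3), not the Clay problem; nothing here claims the
stub, the crux, d = 4 or the mass gap.

THE POINT.  The centre data `q = u↓` of the Thm-2 twist of a competitor satisfies the EXACT identity `q(c₋)·X̄(c)·q(c₊)⁻¹ = W̄(c)`
(✓`Prop7UntwistCornerData.iter_gaugeAct_centre_eq_of_mem`), so its `W̄`-covariant pair differences ARE the coarse twists `X̄(c)W̄(c)⁻¹` — the letter
✓`Prop7UntwistChartOfTwist.exists_untwistedRegauge_of_twist_T3` consumes in sup (`hτ`).  Their `ℓ²` size is governed by the `ℓ²(fine) → ℓ²(coarse)` bound of the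
block average, whose STRAIGHT-LINE part ([Balaban1985Averaging] (42): the segment `[x, x + L^k e_μ]` of every averaging contour) is the purely combinatorial
statement of this file: on the tori `T^{(j)}` of `…Setup`, for ANY seminormed values,
  `Σ_{c=(y,μ)} ‖Σ_{x∈B^k(y)} Σ_{t<L^k} f(x + t e_μ, μ)‖² ≤ (L^{d+2})^k · Σ_b ‖f b‖²`,
i.e. after the normalisation `(L^d)^{−k}` of the mean, `≤ (L^{2−d})^k · Σ_b‖f b‖²` — in `d = 3` the factor `ℓ⁻¹ = L^{−k}` of ROW (T)-L² (pair form).  Mechanism: Cauchy–Schwarz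
over the `(L^d)^k·L^k` summands of one coarse bond, then the EXACT multiplicity identity «every fine bond `(z, μ)` is hit by exactly `L^k` pairs `(x, t)`» — in Lean:
the blocks partition the fine torus (`Finset.sum_fiberwise`) and `x ↦ x + e_μ` is a bijection (✓`B10StarCount.shiftEquiv`) — so NO block-overlap factor appears and the
bound iterates∕composes with constant `1` per level.

WHAT IS PROVED (ns `…Theorems.Prop7BlockLineAverageL2`): §0 `norm_sum_sq_le_card_mul_sum_norm_sq` (‖Σ‖² ≤ card·Σ‖·‖²), `sum_comp_shift_iterate` (translation invariance of
`Σ_x` under `t` steps); §1 one level `j → j+1`: ★`sum_normSq_blockLineSum_le` (constant `L^{d+2}`), ★`sum_normSq_blockLineMean_le` (mean form, `L²∕L^d`); §2 `k` levels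
`0 → k`: ★★`sum_normSq_iterBlockLineSum_le` (`(L^{d+2})^k`), ★★`sum_normSq_iterBlockLineMean_le` (`(L²∕L^d)^k`), `sum_normSq_iterBlockLineMean_le_d3` (`d = 3`: `(L^k)⁻¹`).
HONEST SCOPE.  Lattice combinatorics only; the stair∕`corr ℰ` part of the (0.4) averaging and the nonlinearity of `expMeanLogSU` are NOT treated here (memo §0 (b) caveat, §3).

References: T. Bałaban, CMP 98 (1985) 17–51 [Balaban1985Averaging] ((42)–(43) p.24, Prop. 1–2 pp.19–24); CMP 99 (1985) 389–434 [Balaban1985BackgroundPropagators]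
((3.19)–(3.21) pp.393–394); CMP 109 (1987) 249–301 [Balaban1987RG1] ((0.3)–(0.4) pp.252–253).
-/

set_option autoImplicit false

noncomputable section

open scoped BigOperators
open Finset

namespace Summit.QuantumFields.YangMills.Theorems.Prop7BlockLineAverageL2

open Literature.MathematicalPhysics.QuantumFieldTheory.Balaban1983to89
open B10StarCount (shiftEquiv sum_pbond)
open B5Eq118OneStroke (iterBlockOf iterBlock mem_iterBlock card_iterBlock)

variable {P : Params} {E : Type*} [SeminormedAddCommGroup E]

/-! ## §0 Two bookkeeping lemmas -/

omit [SeminormedAddCommGroup E] in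
/-- Cauchy–Schwarz in the form used for block sums: `‖Σ_{i∈s} g i‖² ≤ |s|·Σ_{i∈s}‖g i‖²`. [folklore] -/
theorem norm_sum_sq_le_card_mul_sum_norm_sq {ι : Type*} {F : Type*} [SeminormedAddCommGroup F] (s : Finset ι) (g : ι → F) :
    ‖∑ i ∈ s, g i‖ ^ 2 ≤ (s.card : ℝ) * ∑ i ∈ s, ‖g i‖ ^ 2 :=
  calc ‖∑ i ∈ s, g i‖ ^ 2 ≤ (∑ i ∈ s, ‖g i‖) ^ 2 := pow_le_pow_left₀ (norm_nonneg _) (norm_sum_le _ _) 2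
    _ ≤ (s.card : ℝ) * ∑ i ∈ s, ‖g i‖ ^ 2 := sq_sum_le_card_mul_sum_sq

/-- Translation invariance of a full lattice sum under `t` unit steps in direction `μ` (`x ↦ x + e_μ` is the bijection ✓`B10StarCount.shiftEquiv`). [folklore] -/
theorem sum_comp_shift_iterate {i : ℕ} {M : Type*} [AddCommMonoid M] (μ : Fin P.d) (t : ℕ) (g : Site P i → M) :
    ∑ x : Site P i, g ((fun z : Site P i => z.shift μ)^[t] x) = ∑ x : Site P i, g x := by
  have hcoe : ((fun z : Site P i => z.shift μ)^[t]) = ⇑((shiftEquiv (P := P) (i := i) μ) ^ t) := by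
    rw [Equiv.Perm.coe_pow]; rfl
  rw [hcoe]
  exact Equiv.sum_comp ((shiftEquiv (P := P) (i := i) μ) ^ t) g

/-! ## §1 One level: `B(y) × [0, L)` against the fine bonds -/

/-- ★ **ONE-LEVEL LINE SUMS, `ℓ²(coarse) ≤ L^{d+2}·ℓ²(fine)`.**  For every coarse bond `c = (y, μ)` of `T^{(j+1)}` sum `f` over the `L^d·L` fine bonds `(x + t e_μ, μ)`,
`x ∈ B(y)`, `t < L` (the straight segments of the averaging contours of [Balaban1985Averaging] (42)); then `Σ_c ‖·‖² ≤ L^{d+2}·Σ_b‖f b‖²` — Cauchy–Schwarz over the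
`L^{d+1}` summands and the exact multiplicity `L` of every fine bond. [cite: Balaban1985Averaging, (42) p.24; Balaban1987RG1, (0.3)-(0.4) pp.252-253] -/
theorem sum_normSq_blockLineSum_le {j : ℕ} (hj : j + 1 ≤ P.m + P.K) (f : PBond P j → E) :
    ∑ c : PBond P (j + 1), ‖∑ x ∈ block c.src, ∑ t ∈ range P.L, f ⟨(fun z : Site P j => z.shift c.dir)^[t] x, c.dir⟩‖ ^ 2
      ≤ (P.L : ℝ) ^ (P.d + 2) * ∑ b : PBond P j, ‖f b‖ ^ 2 := by
  -- per coarse bond: Cauchy–Schwarz over `block y ×ˢ range L`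
  have hcs : ∀ (y : Site P (j + 1)) (μ : Fin P.d),
      ‖∑ x ∈ block y, ∑ t ∈ range P.L, f ⟨(fun z : Site P j => z.shift μ)^[t] x, μ⟩‖ ^ 2
        ≤ (P.L : ℝ) ^ (P.d + 1) * ∑ x ∈ block y, ∑ t ∈ range P.L, ‖f ⟨(fun z : Site P j => z.shift μ)^[t] x, μ⟩‖ ^ 2 := by
    intro y μ
    have h := norm_sum_sq_le_card_mul_sum_norm_sq (block y ×ˢ range P.L)
      (fun p : Site P j × ℕ => f ⟨(fun z : Site P j => z.shift μ)^[p.2] p.1, μ⟩)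
    rw [sum_product, sum_product, card_product, Site.card_block hj, card_range] at h
    have hc : (((P.L ^ P.d * P.L : ℕ)) : ℝ) = (P.L : ℝ) ^ (P.d + 1) := by push_cast; ring
    rw [hc] at h
    exact h
  -- sum over coarse bonds, regroup fiberwise, use translation invariance
  rw [sum_pbond]
  calc ∑ y : Site P (j + 1), ∑ μ : Fin P.d, ‖∑ x ∈ block y, ∑ t ∈ range P.L, f ⟨(fun z : Site P j => z.shift μ)^[t] x, μ⟩‖ ^ 2
      ≤ ∑ y : Site P (j + 1), ∑ μ : Fin P.d,
          (P.L : ℝ) ^ (P.d + 1) * ∑ x ∈ block y, ∑ t ∈ range P.L, ‖f ⟨(fun z : Site P j => z.shift μ)^[t] x, μ⟩‖ ^ 2 :=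
        sum_le_sum fun y _ => sum_le_sum fun μ _ => hcs y μ
    _ = (P.L : ℝ) ^ (P.d + 1) * ∑ μ : Fin P.d, ∑ t ∈ range P.L,
          ∑ y : Site P (j + 1), ∑ x ∈ block y, ‖f ⟨(fun z : Site P j => z.shift μ)^[t] x, μ⟩‖ ^ 2 := by
        rw [sum_comm, mul_sum]
        refine sum_congr rfl fun μ _ => ?_
        rw [← mul_sum, sum_comm]
        congr 1
        refine sum_congr rfl fun y _ => ?_
        rw [sum_comm]
    _ = (P.L : ℝ) ^ (P.d + 1) * ∑ μ : Fin P.d, ∑ t ∈ range P.L, ∑ x : Site P j, ‖f ⟨x, μ⟩‖ ^ 2 := by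
        congr 1
        refine sum_congr rfl fun μ _ => sum_congr rfl fun t _ => ?_
        have hfib : ∑ y : Site P (j + 1), ∑ x ∈ block y, ‖f ⟨(fun z : Site P j => z.shift μ)^[t] x, μ⟩‖ ^ 2
            = ∑ x : Site P j, ‖f ⟨(fun z : Site P j => z.shift μ)^[t] x, μ⟩‖ ^ 2 := by
          rw [← sum_fiberwise univ blockOf (fun x : Site P j => ‖f ⟨(fun z : Site P j => z.shift μ)^[t] x, μ⟩‖ ^ 2)]
          rfl
        rw [hfib, sum_comp_shift_iterate μ t (fun x : Site P j => ‖f ⟨x, μ⟩‖ ^ 2)]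
    _ = (P.L : ℝ) ^ (P.d + 2) * ∑ b : PBond P j, ‖f b‖ ^ 2 := by
        have hR : ∑ b : PBond P j, ‖f b‖ ^ 2 = ∑ μ : Fin P.d, ∑ x : Site P j, ‖f ⟨x, μ⟩‖ ^ 2 := by rw [sum_pbond, sum_comm]
        rw [hR]
        simp only [sum_const, card_range, nsmul_eq_mul, ← mul_sum]
        ring

/-- ★ **MEAN FORM, ONE LEVEL: `Σ_c ‖L^{−d}·(line sum)‖² ≤ (L²∕L^d)·Σ_b‖f b‖²`** — in `d = 3` the factor `L⁻¹`. [cite: Balaban1985Averaging, (42) p.24; Balaban1985BackgroundPropagators, (3.19) p.393] -/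
theorem sum_normSq_blockLineMean_le {j : ℕ} (hj : j + 1 ≤ P.m + P.K) (f : PBond P j → E) :
    ((P.L : ℝ) ^ P.d)⁻¹ ^ 2 * ∑ c : PBond P (j + 1), ‖∑ x ∈ block c.src, ∑ t ∈ range P.L, f ⟨(fun z : Site P j => z.shift c.dir)^[t] x, c.dir⟩‖ ^ 2
      ≤ (P.L : ℝ) ^ 2 / (P.L : ℝ) ^ P.d * ∑ b : PBond P j, ‖f b‖ ^ 2 := by
  have hL : (0 : ℝ) < (P.L : ℝ) := by exact_mod_cast P.L_pos
  have hLd : (0 : ℝ) < (P.L : ℝ) ^ P.d := pow_pos hL _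
  have h := sum_normSq_blockLineSum_le hj f
  have hS : 0 ≤ ∑ b : PBond P j, ‖f b‖ ^ 2 := sum_nonneg fun _ _ => sq_nonneg _
  calc ((P.L : ℝ) ^ P.d)⁻¹ ^ 2 * ∑ c : PBond P (j + 1), ‖∑ x ∈ block c.src, ∑ t ∈ range P.L, f ⟨(fun z : Site P j => z.shift c.dir)^[t] x, c.dir⟩‖ ^ 2
      ≤ ((P.L : ℝ) ^ P.d)⁻¹ ^ 2 * ((P.L : ℝ) ^ (P.d + 2) * ∑ b : PBond P j, ‖f b‖ ^ 2) :=
        mul_le_mul_of_nonneg_left h (by positivity)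
    _ = (P.L : ℝ) ^ 2 / (P.L : ℝ) ^ P.d * ∑ b : PBond P j, ‖f b‖ ^ 2 := by
        field_simp
        ring

/-! ## §2 `k` levels: `B^k(y) × [0, L^k)` against the finest bonds -/

/-- ★★ **`k`-LEVEL LINE SUMS, `ℓ²(T^{(k)} bonds) ≤ (L^{d+2})^k·ℓ²(T^{(0)} bonds)`.**  For every bond `c = (y, μ)` of `T^{(k)}` sum `f` over the `(L^d)^k·L^k` finest bonds
`(x + t e_μ, μ)`, `x ∈ B^k(y)`, `t < L^k` (the straight segments of the `k`-fold averaging contours (43)); then `Σ_c‖·‖² ≤ (L^{d+2})^k·Σ_b‖f b‖²` — constant EXACTLY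
multiplicative in `k` (no block-overlap loss), by the same two facts as §1. [cite: Balaban1985Averaging, (42)-(43) p.24; Balaban1987RG1, (0.3)-(0.4) pp.252-253] -/
theorem sum_normSq_iterBlockLineSum_le (k : ℕ) (hk : k ≤ P.m + P.K) (f : PBond P 0 → E) :
    ∑ c : PBond P k, ‖∑ x ∈ iterBlock k c.src, ∑ t ∈ range (P.L ^ k), f ⟨(fun z : Site P 0 => z.shift c.dir)^[t] x, c.dir⟩‖ ^ 2
      ≤ ((P.L : ℝ) ^ (P.d + 2)) ^ k * ∑ b : PBond P 0, ‖f b‖ ^ 2 := by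
  have hcs : ∀ (y : Site P k) (μ : Fin P.d),
      ‖∑ x ∈ iterBlock k y, ∑ t ∈ range (P.L ^ k), f ⟨(fun z : Site P 0 => z.shift μ)^[t] x, μ⟩‖ ^ 2
        ≤ ((P.L : ℝ) ^ (P.d + 1)) ^ k * ∑ x ∈ iterBlock k y, ∑ t ∈ range (P.L ^ k), ‖f ⟨(fun z : Site P 0 => z.shift μ)^[t] x, μ⟩‖ ^ 2 := by
    intro y μ
    have h := norm_sum_sq_le_card_mul_sum_norm_sq (iterBlock k y ×ˢ range (P.L ^ k))
      (fun p : Site P 0 × ℕ => f ⟨(fun z : Site P 0 => z.shift μ)^[p.2] p.1, μ⟩)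
    rw [sum_product, sum_product, card_product, card_iterBlock k hk, card_range] at h
    have hc : ((((P.L ^ P.d) ^ k * P.L ^ k : ℕ)) : ℝ) = ((P.L : ℝ) ^ (P.d + 1)) ^ k := by push_cast; ring
    rw [hc] at h
    exact h
  rw [sum_pbond]
  calc ∑ y : Site P k, ∑ μ : Fin P.d, ‖∑ x ∈ iterBlock k y, ∑ t ∈ range (P.L ^ k), f ⟨(fun z : Site P 0 => z.shift μ)^[t] x, μ⟩‖ ^ 2
      ≤ ∑ y : Site P k, ∑ μ : Fin P.d,
          ((P.L : ℝ) ^ (P.d + 1)) ^ k * ∑ x ∈ iterBlock k y, ∑ t ∈ range (P.L ^ k), ‖f ⟨(fun z : Site P 0 => z.shift μ)^[t] x, μ⟩‖ ^ 2 :=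
        sum_le_sum fun y _ => sum_le_sum fun μ _ => hcs y μ
    _ = ((P.L : ℝ) ^ (P.d + 1)) ^ k * ∑ μ : Fin P.d, ∑ t ∈ range (P.L ^ k),
          ∑ y : Site P k, ∑ x ∈ iterBlock k y, ‖f ⟨(fun z : Site P 0 => z.shift μ)^[t] x, μ⟩‖ ^ 2 := by
        rw [sum_comm, mul_sum]
        refine sum_congr rfl fun μ _ => ?_
        rw [← mul_sum, sum_comm]
        congr 1
        refine sum_congr rfl fun y _ => ?_
        rw [sum_comm]
    _ = ((P.L : ℝ) ^ (P.d + 1)) ^ k * ∑ μ : Fin P.d, ∑ t ∈ range (P.L ^ k), ∑ x : Site P 0, ‖f ⟨x, μ⟩‖ ^ 2 := by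
        congr 1
        refine sum_congr rfl fun μ _ => sum_congr rfl fun t _ => ?_
        have hfib : ∑ y : Site P k, ∑ x ∈ iterBlock k y, ‖f ⟨(fun z : Site P 0 => z.shift μ)^[t] x, μ⟩‖ ^ 2
            = ∑ x : Site P 0, ‖f ⟨(fun z : Site P 0 => z.shift μ)^[t] x, μ⟩‖ ^ 2 := by
          rw [← sum_fiberwise univ (iterBlockOf k) (fun x : Site P 0 => ‖f ⟨(fun z : Site P 0 => z.shift μ)^[t] x, μ⟩‖ ^ 2)]
          refine sum_congr rfl fun y _ => sum_congr ?_ fun _ _ => rfl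
          ext x
          simp [iterBlock]
        rw [hfib, sum_comp_shift_iterate μ t (fun x : Site P 0 => ‖f ⟨x, μ⟩‖ ^ 2)]
    _ = ((P.L : ℝ) ^ (P.d + 2)) ^ k * ∑ b : PBond P 0, ‖f b‖ ^ 2 := by
        have hR : ∑ b : PBond P 0, ‖f b‖ ^ 2 = ∑ μ : Fin P.d, ∑ x : Site P 0, ‖f ⟨x, μ⟩‖ ^ 2 := by rw [sum_pbond, sum_comm]
        rw [hR]
        simp only [sum_const, card_range, nsmul_eq_mul, ← mul_sum]
        push_cast
        ring

/-- ★★ **MEAN FORM, `k` LEVELS: `((L^d)^k)⁻²·Σ_c‖line sum‖² ≤ (L²∕L^d)^k·Σ_b‖f b‖²`** — the `ℓ²(fine) → ℓ²(coarse)` bound `(L^{2−d})^{k}` of the straight-line part of the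
`k`-fold average with its printed weights `L^{−dk}`. [cite: Balaban1985Averaging, (42)-(43) p.24; Balaban1985BackgroundPropagators, (3.19) p.393] -/
theorem sum_normSq_iterBlockLineMean_le (k : ℕ) (hk : k ≤ P.m + P.K) (f : PBond P 0 → E) :
    (((P.L : ℝ) ^ P.d) ^ k)⁻¹ ^ 2 * ∑ c : PBond P k, ‖∑ x ∈ iterBlock k c.src, ∑ t ∈ range (P.L ^ k), f ⟨(fun z : Site P 0 => z.shift c.dir)^[t] x, c.dir⟩‖ ^ 2
      ≤ ((P.L : ℝ) ^ 2 / (P.L : ℝ) ^ P.d) ^ k * ∑ b : PBond P 0, ‖f b‖ ^ 2 := by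
  have hL : (0 : ℝ) < (P.L : ℝ) := by exact_mod_cast P.L_pos
  have hLd : (0 : ℝ) < ((P.L : ℝ) ^ P.d) ^ k := pow_pos (pow_pos hL _) _
  have h := sum_normSq_iterBlockLineSum_le k hk f
  have hS : 0 ≤ ∑ b : PBond P 0, ‖f b‖ ^ 2 := sum_nonneg fun _ _ => sq_nonneg _
  calc (((P.L : ℝ) ^ P.d) ^ k)⁻¹ ^ 2 * ∑ c : PBond P k, ‖∑ x ∈ iterBlock k c.src, ∑ t ∈ range (P.L ^ k), f ⟨(fun z : Site P 0 => z.shift c.dir)^[t] x, c.dir⟩‖ ^ 2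
      ≤ (((P.L : ℝ) ^ P.d) ^ k)⁻¹ ^ 2 * (((P.L : ℝ) ^ (P.d + 2)) ^ k * ∑ b : PBond P 0, ‖f b‖ ^ 2) :=
        mul_le_mul_of_nonneg_left h (by positivity)
    _ = ((P.L : ℝ) ^ 2 / (P.L : ℝ) ^ P.d) ^ k * ∑ b : PBond P 0, ‖f b‖ ^ 2 := by
        rw [div_pow, ← mul_assoc]
        congr 1
        field_simp
        ring

/-- `d = 3` reading: `((L³)^k)⁻²·Σ_c‖line sum‖² ≤ (L^k)⁻¹·Σ_b‖f b‖²` — the factor `ℓ⁻¹`, `ℓ = L^k`, of ROW (T)-L² (pair form). [cite: Balaban1985Averaging, (42)-(43) p.24] -/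
theorem sum_normSq_iterBlockLineMean_le_d3 (hd : P.d = 3) (k : ℕ) (hk : k ≤ P.m + P.K) (f : PBond P 0 → E) :
    (((P.L : ℝ) ^ P.d) ^ k)⁻¹ ^ 2 * ∑ c : PBond P k, ‖∑ x ∈ iterBlock k c.src, ∑ t ∈ range (P.L ^ k), f ⟨(fun z : Site P 0 => z.shift c.dir)^[t] x, c.dir⟩‖ ^ 2
      ≤ ((P.L : ℝ) ^ k)⁻¹ * ∑ b : PBond P 0, ‖f b‖ ^ 2 := by
  have hL : (0 : ℝ) < (P.L : ℝ) := by exact_mod_cast P.L_pos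
  have h := sum_normSq_iterBlockLineMean_le k hk f
  have he : ((P.L : ℝ) ^ 2 / (P.L : ℝ) ^ P.d) ^ k = ((P.L : ℝ) ^ k)⁻¹ := by
    rw [hd, ← inv_pow]
    congr 1
    field_simp
  rwa [he] at h

end Summit.QuantumFields.YangMills.Theorems.Prop7BlockLineAverageL2

end
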